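import Summits.BirchSwinnertonDyer.BirchSwinnertonDyer.Theorems.KimAtThreeKolyvaginDeepUpperRung
import Literature.NumberTheory.EllipticCurves.KimNakamura2020.RankZeroShaBound
import HarnessLib

/-!
# Route `KimAtThreeKolyvagin` (rung W2), crux `DeepUpperAtThree`: the rung on the WHOLE additive locus
# (potentially multiplicative rows included) from Kim–Nakamura 2020

`KimAtThreeKolyvaginDeepUpperRung` proves the deep-term-dropped truncation
`ord₃ #Ш(E/ℚ)(3) ≤ ∂⁽⁰⁾(δ̃)` of the crux `DeepUpperAtThree` (item `stmt-BirchSwinnertonDyer-19076`) on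
Kato's printed stratum — `3` additive and POTENTIALLY GOOD (Kato 2004 Thm. 14.5 (3) excludes the
potentially multiplicative case at weight `2`). The planner's birth decomposition of the crux is by
`ord₃ j(E) ≥ 0` / `< 0` (`stub_upper_potGood` / `stub_upper_potMult`), and the potentially
MULTIPLICATIVE stratum (Kodaira `I_n^*` at `3`) has its own printed Euler-system inequality: Kim–Nakamura,
J. Number Theory 210 (2020), Thm. 1.7 with Rem. 1.8 (1) (tree fact
`KimNakamura2020.rankZero_padicValNat_sha_le_of_maninConstant`: ADDITIVE odd `p`, no potential-good
hypothesis; at `p = 3` under Assumption 2.5 "not exceptional" = `KimNakamura2020.NonExceptional W 3`,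
Assumption 1.1 (1) `3 ∤ ∏ c_ℓ`, `3 ∤ ℓ − 1` / `3 ∤ ℓ + 1` at split / non-split multiplicative `ℓ`, the
tower, a Manin datum). This file reads that fact in the crux's `∂`-currency through the landed bridge
`natCast_le_kuriharaPartial_zero_of_le_padicValRat`:
* `deepUpperAtThree_truncation_additive_of_kimNakamura2020` — the rung on every additive row meeting
  KN20's printed side conditions (so on the potentially multiplicative rows too);
* `truncationAdditive_of_deepUpperAtThree` — kernel certificate that it is a rung of the crux.
Every printed input is a hypothesis BY NAME; nothing is asserted; the crux stays open.
[cite: KimNakamura2020, Thm. 1.7 and Rem. 1.8 (1) (arXiv p. 4), Assumption 1.1 (arXiv p. 3), Assumption 2.5 (arXiv p. 5)]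
[cite: Kim2022StructureSelmer, §1.5.1 (PDF p. 7)] [cite: Kim2025RefinedTNC, Thm 1.1]
-/

set_option autoImplicit false
-- the Theorems namespace of a single-conjunct summit repeats the summit name by design (D-0017)
set_option linter.dupNamespace false

noncomputable section

open scoped MatrixGroups ModularForm Classical

open CongruenceSubgroup WeierstrassCurve Literature.NumberTheory.EllipticCurves
  Literature.NumberTheory.EllipticCurves.ModularForms

namespace Summit.BirchSwinnertonDyer.BirchSwinnertonDyer.Theorems.KimAtThreeKolyvaginDeepUpperRungAdditive

open Summit.BirchSwinnertonDyer.Rank1Residual.Additive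
open Summit.BirchSwinnertonDyer.BirchSwinnertonDyer.Theses.KimAtThreeKolyvagin
open Summit.BirchSwinnertonDyer.BirchSwinnertonDyer.Theorems.KimAtThreeKolyvaginDeepUpperRung

/-- **Rung of `DeepUpperAtThree` on the whole additive locus at `3` from Kim–Nakamura 2020** (`hKN` =
Thm. 1.7 / Rem. 1.8 (1), inequality form, named fact). For `W/ℚ` globally minimal with `ρ̄_{E,3^n}`
onto for all `n`, `Ш(E/ℚ)` finite, `f` the newform of `W` (crux binders carried verbatim), `3` ADDITIVE
(potentially good OR potentially multiplicative), `(E, 3)` not exceptional (KN20 Assumption 2.5),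
`3 ∤ ∏ c_ℓ`, `3 ∤ ℓ − 1` at every split and `3 ∤ ℓ + 1` at every non-split multiplicative prime `ℓ`
(Assumption 1.1 (1)), the period transfer `Ω(W) = u · Ω⁺_f` with `|u|₃ = 1`, and a parametrisation
datum `D` with `3 ∤ c_D` (Assumption 1.1 (3)): `ord₃ #Ш(E/ℚ)(3) ≤ ∂⁽⁰⁾(δ̃)`.
[cite: KimNakamura2020, Thm. 1.7 and Rem. 1.8 (1) (arXiv p. 4), Thm. 4.2 (2) and (4.3) (arXiv pp. 9–10)]
[cite: Kim2022StructureSelmer, §1.5.1 (PDF p. 7)] -/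
theorem deepUpperAtThree_truncation_additive_of_kimNakamura2020
    (hKN : KimNakamura2020.rankZero_padicValNat_sha_le_of_maninConstant) :
    ∀ (W : WeierstrassCurve ℚ) [W.IsElliptic] [W.IsGloballyMinimal],
      (∀ n : ℕ, W.HasSurjectiveModNGaloisRep (3 ^ n : ℕ)) →
      Finite W.sha →
      ∀ {N : ℕ} [NeZero N] (f : CuspForm (Gamma0 N) 2), IsNewformOf W f →
      (∀ r : ℚ, ratPlusSymbol f r ≠ 0 → 0 ≤ padicValRat 3 (ratPlusSymbol f r)) →
      kuriharaVanishingOrder W 3 f = 0 →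
      ¬ W.HasGoodReductionAtPrime 3 → ¬ W.HasMultiplicativeReductionAtPrime 3 →
      KimNakamura2020.NonExceptional W 3 →
      ¬ 3 ∣ W.tamagawaProduct →
      (∀ (ℓ : ℕ) [Fact ℓ.Prime], W.HasMultiplicativeReductionAtPrime ℓ →
        (W.HasSplitMultiplicativeReductionAtPrime ℓ → ¬ 3 ∣ ℓ - 1) ∧
          (¬ W.HasSplitMultiplicativeReductionAtPrime ℓ → ¬ 3 ∣ ℓ + 1)) →
      (∃ u : ℚ, ‖(u : ℚ_[3])‖ = 1 ∧ W.realPeriodRat = u * plusPeriod f) →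
      ∀ {N' : ℕ} [NeZero N'] (D : ModularParametrizationData W N'), ¬ (3 : ℤ) ∣ D.maninConstant →
        ((padicValNat 3 (Nat.card (AddCommGroup.primaryComponent W.sha 3)) : ℕ) : ℕ∞) ≤
          kuriharaPartial W 3 f 0 := by
  intro W _ _ htower hfin N _ f hf _ _ hgood hmult hNE htam hmul hper N' _ D hc
  by_cases h0 : ratPlusSymbol f 0 = 0
  · rw [kuriharaPartial_zero_eq_top_of_ratPlusSymbol_eq_zero W 3 f h0]
    exact le_top
  · obtain ⟨q, hq, hle⟩ := hKN W 3 (by norm_num) hgood hmult (Or.inr hNE) htower htam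
      (fun ℓ _ hℓ => hmul ℓ hℓ) (hf.entireLFunction_one_ne_zero_of_ratPlusSymbol_zero_ne_zero h0)
      hfin D hc
    exact natCast_le_kuriharaPartial_zero_of_le_padicValRat W 3 f (by norm_num)
      (hasIrreducibleModPGaloisRep_of_hasSurjectiveModNGaloisRep W 3 (by simpa using htower 1))
      hf hper hq hle

/-- `DeepUpperAtThree` implies the additive-locus rung outright (drop `d`, ignore KN20's side
conditions). [cite: Kim2025RefinedTNC, Thm 1.1] -/
theorem truncationAdditive_of_deepUpperAtThree (h : DeepUpperAtThree) :
    ∀ (W : WeierstrassCurve ℚ) [W.IsElliptic] [W.IsGloballyMinimal],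
      (∀ n : ℕ, W.HasSurjectiveModNGaloisRep (3 ^ n : ℕ)) →
      Finite W.sha →
      ∀ {N : ℕ} [NeZero N] (f : CuspForm (Gamma0 N) 2), IsNewformOf W f →
      (∀ r : ℚ, ratPlusSymbol f r ≠ 0 → 0 ≤ padicValRat 3 (ratPlusSymbol f r)) →
      kuriharaVanishingOrder W 3 f = 0 →
      ¬ W.HasGoodReductionAtPrime 3 → ¬ W.HasMultiplicativeReductionAtPrime 3 →
      KimNakamura2020.NonExceptional W 3 →
      ¬ 3 ∣ W.tamagawaProduct →
      (∀ (ℓ : ℕ) [Fact ℓ.Prime], W.HasMultiplicativeReductionAtPrime ℓ →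
        (W.HasSplitMultiplicativeReductionAtPrime ℓ → ¬ 3 ∣ ℓ - 1) ∧
          (¬ W.HasSplitMultiplicativeReductionAtPrime ℓ → ¬ 3 ∣ ℓ + 1)) →
      (∃ u : ℚ, ‖(u : ℚ_[3])‖ = 1 ∧ W.realPeriodRat = u * plusPeriod f) →
      ∀ {N' : ℕ} [NeZero N'] (D : ModularParametrizationData W N'), ¬ (3 : ℤ) ∣ D.maninConstant →
        ((padicValNat 3 (Nat.card (AddCommGroup.primaryComponent W.sha 3)) : ℕ) : ℕ∞) ≤
          kuriharaPartial W 3 f 0 := by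
  intro W _ _ htower hfin N _ f hf hint hord _ _ _ _ _ _ N' _ _ _
  obtain ⟨d, -, hle⟩ := h W htower hfin f hf hint hord
  exact le_trans (by exact_mod_cast Nat.le_add_right _ d) hle

end Summit.BirchSwinnertonDyer.BirchSwinnertonDyer.Theorems.KimAtThreeKolyvaginDeepUpperRungAdditive

end
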